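import Mathlib.Analysis.SpecialFunctions.SmoothTransition
import Mathlib.Analysis.Calculus.Deriv.Slope
import Mathlib.Analysis.Calculus.FDeriv.Mul
import Mathlib.Analysis.Calculus.ContDiff.Basic
import HarnessLib

/-!
# Interpolating two clocks without creating critical points

Topic `Geometry/Riemannian` (fact seat
`provefact-Literature.Geometry.Riemannian.LawsonMichelsohn1984_surrounding`).  Everything here
is **proved**; no definitions.

In the endgame of Lawson–Michelsohn's Thm. 6.1 (`MeanConvexSurroundingEndgame.lean`) the strong
isotopy is the gradient collar of one function `g` on `ℝ^{m+1}` without critical points between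
the hypersurface `e(N) = ∂D = {F = 0}` (where `g = 1`) and the mean-convex core (where `g = 0`).
Near `∂D` the only available clock smooth *across* `∂D` is the defining function `F` itself
(`1 + F/c`); inside, the clock is the (rescaled) Morse function `f̃` of the domain, smooth only on
the interior `{F < 0}`.  This file interpolates the two on the band `{-2η ≤ F ≤ -η}`:

* `exists_clockInterpolation` — with a smooth monotone step `μ` (`= 0` below `-2η`, `= 1` above
  `-η`), `g = μ(F) (1 + F/c) + (1 - μ(F)) f̃` is smooth on all of `ℝ^{m+1}`, equals `1 + F/c` on
  `{F ≥ -η}` and `f̃` on `{F ≤ -2η}`, lies between the two clocks, and — if a vector field `V` has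
  `dF(V) = 1` on `{-2η ≤ F ≤ 0}`, `df̃(V) ≥ κ > 0` and `f̃ ≤ 1 + F/c` on the band — satisfies
  **`dg(V) > 0` on `{-2η ≤ F ≤ 0}`**: `dg(V) = μ'(F)(1 + F/c - f̃) + μ(F)/c + (1 - μ(F)) df̃(V)`,
  three non-negative terms of which the last two do not vanish together.

## References

* H. B. Lawson, Jr., M.-L. Michelsohn, *Embedding and surrounding with positive mean curvature*,
  Invent. Math. 77 (1984), proof of Thm. 6.1. [LawsonMichelsohn1984]
* J. Milnor, *Morse theory* (1963), §3 (modifying functions on a band without new critical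
  points). [Milnor1963]
-/

noncomputable section

open Set Function Filter
open scoped Topology ContDiff

namespace Literature.Geometry.Riemannian

variable {E : Type*} [NormedAddCommGroup E] [NormedSpace ℝ E]

/-- **A smooth monotone step**: `μ = 0` on `(-∞, -2η]`, `μ = 1` on `[-η, ∞)`, `0 ≤ μ ≤ 1`, `μ`
monotone and `C^∞` (`Real.smoothTransition ((t + 2η)/η)`). [folklore] -/
theorem exists_smooth_step {η : ℝ} (hη : 0 < η) :
    ∃ μ : ℝ → ℝ, ContDiff ℝ ∞ μ ∧ Monotone μ ∧ (∀ t, μ t ∈ Icc (0 : ℝ) 1) ∧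
      (∀ t, t ≤ -(2 * η) → μ t = 0) ∧ (∀ t, -η ≤ t → μ t = 1) := by
  refine ⟨fun t => Real.smoothTransition ((t + 2 * η) / η), ?_, ?_, fun t => ?_, fun t ht => ?_,
    fun t ht => ?_⟩
  · exact Real.smoothTransition.contDiff.comp ((contDiff_id.add contDiff_const).div_const η)
  · exact Real.smoothTransition.monotone.comp fun a b hab => by
      show (a + 2 * η) / η ≤ (b + 2 * η) / η
      gcongr
  · exact ⟨Real.smoothTransition.nonneg _, Real.smoothTransition.le_one _⟩
  · exact Real.smoothTransition.zero_of_nonpos (div_nonpos_of_nonpos_of_nonneg (by linarith) hη.le)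
  · refine Real.smoothTransition.one_of_one_le ?_
    rw [le_div_iff₀ hη]; linarith

/-- **Interpolating two clocks without creating critical points.**  Let `F` be smooth, `f̃`
smooth on `{F < 0}`, `η, c > 0`.  There is a smooth `g` on all of `E` with `g = 1 + F/c` on
`{F ≥ -η}`, `g = f̃` on `{F ≤ -2η}`, `min (f̃, 1 + F/c) ≤ g ≤ max (f̃, 1 + F/c)` everywhere; and if a
vector field `V` satisfies `dF(V) = 1` on `{-2η ≤ F ≤ 0}`, `df̃(V) ≥ κ > 0` and `f̃ ≤ 1 + F/c` on
`{-2η ≤ F ≤ -η}`, then `dg(V) > 0` on `{-2η ≤ F ≤ 0}` (so `g` has no critical points there).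
[cite: Milnor1963, §3] -/
theorem exists_clockInterpolation {F f' : E → ℝ} (hF : ContDiff ℝ ∞ F)
    (hf' : ContDiffOn ℝ ∞ f' {x | F x < 0}) {η c : ℝ} (hη : 0 < η) (hc : 0 < c) :
    ∃ g : E → ℝ, ContDiff ℝ ∞ g ∧ (∀ x, -η ≤ F x → g x = 1 + F x / c) ∧
      (∀ x, F x ≤ -(2 * η) → g x = f' x) ∧
      (∀ x, min (f' x) (1 + F x / c) ≤ g x) ∧ (∀ x, g x ≤ max (f' x) (1 + F x / c)) ∧
      ∀ (V : E → E) (κ : ℝ), 0 < κ → (∀ x, F x ∈ Icc (-(2 * η)) 0 → fderiv ℝ F x (V x) = 1) →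
        (∀ x, F x ∈ Icc (-(2 * η)) (-η) → κ ≤ fderiv ℝ f' x (V x)) →
        (∀ x, F x ∈ Icc (-(2 * η)) (-η) → f' x ≤ 1 + F x / c) →
        ∀ x, F x ∈ Icc (-(2 * η)) 0 → 0 < fderiv ℝ g x (V x) := by
  obtain ⟨μ, hμc, hμm, hμ01, hμ0, hμ1⟩ := exists_smooth_step hη
  set g : E → ℝ := fun x => μ (F x) * (1 + F x / c) + (1 - μ (F x)) * f' x with hg
  -- the two representations
  have hrep1 : ∀ x, -η ≤ F x → g x = 1 + F x / c := fun x hx => by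
    simp only [hg, hμ1 _ hx]; ring
  have hrep0 : ∀ x, F x ≤ -(2 * η) → g x = f' x := fun x hx => by
    simp only [hg, hμ0 _ hx]; ring
  have hopen1 : IsOpen {x : E | -η < F x} := isOpen_lt continuous_const hF.continuous
  have hopen0 : IsOpen {x : E | F x < 0} := isOpen_lt hF.continuous continuous_const
  have hev1 : ∀ x, -η < F x → g =ᶠ[𝓝 x] fun y => 1 + F y / c := fun x hx =>
    (hopen1.eventually_mem hx).mono fun y hy => hrep1 y (le_of_lt hy)
  -- smoothness
  have hA : ContDiff ℝ ∞ fun y => 1 + F y / c := contDiff_const.add (hF.div_const c)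
  have hμF : ContDiff ℝ ∞ fun y => μ (F y) := hμc.comp hF
  have hgc : ContDiff ℝ ∞ g := by
    rw [contDiff_iff_contDiffAt]
    intro x
    rcases lt_or_ge (F x) 0 with hx | hx
    · have hf'x : ContDiffAt ℝ ∞ f' x := hf'.contDiffAt (hopen0.mem_nhds hx)
      exact (hμF.contDiffAt.mul hA.contDiffAt).add
        ((contDiffAt_const.sub hμF.contDiffAt).mul hf'x)
    · exact hA.contDiffAt.congr_of_eventuallyEq (hev1 x (by linarith))
  -- between the two clocks
  have hbetween : ∀ x, min (f' x) (1 + F x / c) ≤ g x ∧ g x ≤ max (f' x) (1 + F x / c) := by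
    intro x
    obtain ⟨h0, h1⟩ := hμ01 (F x)
    have hgx : g x = μ (F x) * (1 + F x / c) + (1 - μ (F x)) * f' x := rfl
    constructor
    · rw [hgx]
      nlinarith [min_le_left (f' x) (1 + F x / c), min_le_right (f' x) (1 + F x / c)]
    · rw [hgx]
      nlinarith [le_max_left (f' x) (1 + F x / c), le_max_right (f' x) (1 + F x / c)]
  refine ⟨g, hgc, hrep1, hrep0, fun x => (hbetween x).1, fun x => (hbetween x).2,
    fun V κ hκ hV htrans hle x hx => ?_⟩
  rcases lt_or_ge (-η) (F x) with hx1 | hx1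
  · -- above `-η`: `g = 1 + F/c` near `x`
    rw [(hev1 x hx1).fderiv_eq]
    have hd : HasFDerivAt (fun y => 1 + F y / c) (c⁻¹ • fderiv ℝ F x) x := by
      have h := ((hF.differentiable (by simp) x).hasFDerivAt.mul_const c⁻¹).const_add 1
      have heq : (fun y => 1 + F y / c) = fun y => 1 + F y * c⁻¹ := by
        funext y; rw [div_eq_mul_inv]
      rw [heq]; exact h
    rw [hd.fderiv, smul_apply, hV x hx, smul_eq_mul, mul_one]
    positivity
  · -- on the band `[-2η, -η]`: differentiate the full formula
    have hxb : F x ∈ Icc (-(2 * η)) (-η) := ⟨hx.1, hx1⟩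
    have hx0 : F x < 0 := by linarith
    have hFx : HasFDerivAt F (fderiv ℝ F x) x := (hF.differentiable (by simp) x).hasFDerivAt
    have hf'x : HasFDerivAt f' (fderiv ℝ f' x) x :=
      ((hf'.contDiffAt (hopen0.mem_nhds hx0)).differentiableAt (by simp)).hasFDerivAt
    have hμd : HasDerivAt μ (deriv μ (F x)) (F x) :=
      ((hμc.differentiable (by simp)) (F x)).hasDerivAt
    have hμFx : HasFDerivAt (fun y => μ (F y)) (deriv μ (F x) • fderiv ℝ F x) x :=
      hμd.comp_hasFDerivAt x hFx
    have hAx : HasFDerivAt (fun y => 1 + F y / c) (c⁻¹ • fderiv ℝ F x) x := by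
      have h := (hFx.mul_const c⁻¹).const_add 1
      have heq : (fun y => 1 + F y / c) = fun y => 1 + F y * c⁻¹ := by
        funext y; rw [div_eq_mul_inv]
      rw [heq]; exact h
    have h1 := hμFx.mul hAx
    have h2 := (hμFx.const_sub 1).mul hf'x
    have hsum := h1.add h2
    have hgfun : g = ((fun y => μ (F y)) * fun y => 1 + F y / c) + (fun y => 1 - μ (F y)) * f' := by
      funext y; simp only [hg, Pi.add_apply, Pi.mul_apply]
    rw [hgfun, hsum.fderiv]
    simp only [add_apply, smul_apply, neg_apply, hV x hx, smul_eq_mul, mul_one]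
    -- `dg(V) = μ'(1 + F/c - f̃) + μ/c + (1 - μ) df̃(V)`
    have hμ' : 0 ≤ deriv μ (F x) := hμm.deriv_nonneg
    obtain ⟨hμ0', hμ1'⟩ := hμ01 (F x)
    have hgap : 0 ≤ 1 + F x / c - f' x := by linarith [hle x hxb]
    have hκ' : κ ≤ fderiv ℝ f' x (V x) := htrans x hxb
    have hcinv : 0 < c⁻¹ := inv_pos.2 hc
    nlinarith [mul_nonneg hμ' hgap, mul_nonneg hμ0' hcinv.le,
      mul_nonneg (sub_nonneg.2 hμ1') (hκ.le.trans hκ'), hκ, hcinv]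

end Literature.Geometry.Riemannian

end
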